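import Summits.QuantumFields.BalabanUV.Beta.FP.TowerDoorDefectLoc

/-!
# `BalabanUV.Beta.FP.TowerDoorDefectLinear` — road «FP», binder row D1: **THE WARD-DEFECT KERNEL IS LINEAR IN THE GAUGE FUNCTION UNDER AN `ℓ¹`-BOUNDED SUPERPOSITION** ((T2)'s first socket)
# (an2 J-NOTE-21 §5 (T2): «`Σ_{m₁} DefKerℤ (λℤ_(μ,y)) (β̄ + Mc m₁)(…)` = … `Σ_{m₁} shiftK (−T m₁) (DefKerℤ (λℤ_(μ, y + Mc m₁)) β̄)(…)`; … the gauge factor becomes `Σ_t λℤ_(μ, y + Mc t)`» —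
# the step where the sum over the source copies moves INSIDE the gauge-function slot of PART 62's `defKerZ`.)

WHAT ([folklore] `tsum` bookkeeping BY NAME over PART 62's `defKerZ ∕ M2Z` and PART 64's `biLoc_M2Z`; generic letters `L tabs κ₂`, a generic family `v : ι → Site (3+1) → ℝ`; no `def`,
no `def … : Prop`, nothing cited, 0 sorry, default heartbeats).
§1 **`summable_abs_M2Z_bond`** — under (Lmix) at rate `δ > 0` the symmetrised mixed table is absolutely summable over its fine bond at fixed legs: `Σ_u |M2Z L tabs (u,κ) β x w a b| < ∞`
(PART 64 `biLoc_M2Z`, the window factor and the `w`-leg factor dropped, lit `summable_exp_shift'`).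
§2 **`defKerZ_tsum`** — for a family of gauge functions `v t` with `Σ'_t |v t u| ≤ V` at every site (`habs`, `hV`) and (Lmix) at rate `δ > 0`:
`defKerZ L tabs κ₂ (fun u => Σ'_t v t u) β x w a b = Σ'_t defKerZ L tabs κ₂ (v t) β x w a b` — the gradient term by ONE Fubini on `(t, u)` (lit `summable_prod_of_nonneg` on the majorant
`(|v t (u+e_κ)| + |v t u|)·|M2Z (u,κ) β x w|`, lit `Summable.tsum_comm'`), the commutator term by `tsum_mul_right ∕ tsum_mul_left`, the finite direction sum by lit `Summable.tsum_finsetSum`;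
the multiplier legs are `0 = Σ' 0`.  With `v t := λℤ_(μ, y + Mc•t)` (an2 PART 59 `exists_tsum_abs_lamZ_record_sources_le` gives `V`) this is the step of (T2) that replaces the source-wound
family of defect kernels by the defect kernel of the PERIODISED gauge function `Σ_t λℤ_(μ, y + Mc•t)` = the tree-gauge read-out `lv` (an2 PART 57).
WHAT THIS IS NOT: not (T2) (the torus-side evaluation of `perF ∘ dper` on the periodised gauge function, the `wΦ`-winding and v10's scalars are separate steps), not `hX`;
nothing of Bałaban's asserted, valued or discharged; 0 estimates; 0∕4 row-D1 binders (hW, hR, D1Tel, D1Rep); v10 NOT filed; NOT (C1), NOT (T-ID), NOT D1, NEVER «G-an2-4 closed»,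
NOT BetaPertH, NOT continuum, NOT Clay.
HONEST DEPENDENCY (page 1, mandatory): continuum YM on T⁴ ⇐ BetaPertH ∧ nine spine estimates (0/9 proved); BetaPertH ⇐ (D1) ∧ (D4) ∧ CAP+tail;
G-an2-4 gates asym, D1 and NE2/3/4.  HONEST FRAMING (cell contract, verbatim): «discharging `BetaPertH` makes Bałaban's UV stability UNCONDITIONAL —
a real constructive-QFT result; it is NOT the continuum limit and NOT the Clay problem.»  ABSOLUTE RULE (cell charter, verbatim): «No internally-minted
statement may enter as a cited fact. Every hypothesis is either kernel-proved in this package or a verbatim quotation of a PUBLISHED theorem with page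
reference. The manuscript(s) under audit are NOT citable for their own disputed steps — they are the thing under adjudication; programme-internal
(2001/route/tribunal) claims are never citable.»  Road «FP» OWNER, b2b-balaban-beta-d1-p3 gen 55, 2026-08-29.  No existing file touched.
-/

noncomputable section

open Finset
open scoped BigOperators
open Literature.MathematicalPhysics.QuantumFieldTheory
open Literature.MathematicalPhysics.QuantumFieldTheory.Balaban1983to89
open Literature.MathematicalPhysics.QuantumFieldTheory.Balaban1983to89.Beta
open Literature.MathematicalPhysics.QuantumFieldTheory.Balaban1983to89.B12Sec2to5 (l1 l1_nonneg)
open AffineAveraging (Site unitVec)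
open OneStepResolventKernel (Fib)
open ExpKernelCalculus (MKer BiLoc summable_exp_shift')
open SecondOrderResponse (LocStencilFM)
open BalabanStepW2 (wM2)
open Summit.QuantumFields.BalabanUV.Beta.SymmetrisedStepJets (SymTables)
open Summit.QuantumFields.BalabanUV.Beta.FP.TowerDoorDefectDefs
open Summit.QuantumFields.BalabanUV.Beta.FP.TowerDoorDefectLoc (biLoc_M2Z)

namespace Summit.QuantumFields.BalabanUV.Beta.FP.TowerDoorDefectLinear

variable (L : ℕ) (tabs : SymTables 3 L)

/-! ## §1 The mixed table is absolutely summable over its fine bond -/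

/-- [folklore] **`abs_M2Z_bond_le`** — (Lmix) at rate `δ ≥ 0` ⟹ `|M2Z L tabs (u,κ) β x w a b| ≤ (wM2·C)·e^{−δ|x − u|₁}` (PART 64 `biLoc_M2Z` with the window factor and the `w`-leg factor dropped). -/
theorem abs_M2Z_bond_le {C δ : ℝ} (hmix : LocStencilFM L tabs.mixFF C δ) (hδ : 0 ≤ δ) (κ : Fin (3 + 1)) (β : Site (3 + 1) × Fin (3 + 1))
    (x w : Site (3 + 1)) (a b : Fib 3) (u : Site (3 + 1)) :
    |M2Z L tabs (u, κ) β x w a b| ≤ (|wM2 3 L 0| * C) * Real.exp (-δ * l1 (x - u)) := by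
  have hC : 0 ≤ C := hmix.nonneg
  have h := biLoc_M2Z L tabs hmix u κ β x w a b
  refine h.trans ?_
  have e1 : Real.exp (-δ * l1 (u - ((L : ℕ) : ℤ) • β.1)) ≤ 1 := by
    rw [Real.exp_le_one_iff]; nlinarith [l1_nonneg (u - ((L : ℕ) : ℤ) • β.1)]
  have e2 : Real.exp (-δ * (l1 (x - u) + l1 (w - u))) ≤ Real.exp (-δ * l1 (x - u)) := by
    rw [Real.exp_le_exp]; nlinarith [l1_nonneg (w - u)]
  calc |wM2 3 L 0| * (C * Real.exp (-δ * l1 (u - ((L : ℕ) : ℤ) • β.1))) * Real.exp (-δ * (l1 (x - u) + l1 (w - u)))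
      ≤ |wM2 3 L 0| * (C * 1) * Real.exp (-δ * l1 (x - u)) :=
        mul_le_mul (mul_le_mul_of_nonneg_left (mul_le_mul_of_nonneg_left e1 hC) (abs_nonneg _)) e2 (Real.exp_pos _).le (by positivity)
    _ = _ := by ring

/-- [folklore] **`summable_abs_M2Z_bond`** — (Lmix) at rate `δ > 0` ⟹ `Σ_u |M2Z L tabs (u,κ) β x w a b| < ∞`. -/
theorem summable_abs_M2Z_bond {C δ : ℝ} (hmix : LocStencilFM L tabs.mixFF C δ) (hδ : 0 < δ) (κ : Fin (3 + 1)) (β : Site (3 + 1) × Fin (3 + 1))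
    (x w : Site (3 + 1)) (a b : Fib 3) :
    Summable fun u : Site (3 + 1) => |M2Z L tabs (u, κ) β x w a b| := by
  refine Summable.of_nonneg_of_le (fun u => abs_nonneg _) (fun u => abs_M2Z_bond_le L tabs hmix hδ.le κ β x w a b u) ?_
  have hs := (ExpKernelCalculus.summable_exp_shift hδ x).mul_left (|wM2 3 L 0| * C)
  exact hs

/-! ## §2 `defKerZ` of an `ℓ¹`-bounded superposition of gauge functions -/

variable {ι : Type*}

/-- [folklore] one member of an `ℓ¹`-bounded family is bounded by the family's sum: `|v t u| ≤ Σ'_t |v t u| ≤ V`. -/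
theorem abs_le_of_tsum_abs_le {v : ι → Site (3 + 1) → ℝ} {V : ℝ} (habs : ∀ u, Summable fun t => |v t u|) (hV : ∀ u, ∑' t, |v t u| ≤ V)
    (t : ι) (u : Site (3 + 1)) : |v t u| ≤ V :=
  ((habs u).le_tsum t (fun _ _ => abs_nonneg _)).trans (hV u)

/-- [folklore] the shifted-difference family `(u, t) ↦ (v t (u+e) − v t u)·M u` is absolutely summable on `Site × ι` when `Σ'_t |v t ·| ≤ V` pointwise and `Σ_u |M u| < ∞`
(lit `summable_prod_of_nonneg` on the majorant `(|v t (u+e)| + |v t u|)·|M u|`, fibres in `t` first; lit `Summable.of_norm_bounded`). -/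
theorem summable_uncurry_shiftDiff_mul {v : ι → Site (3 + 1) → ℝ} {V : ℝ} (habs : ∀ u, Summable fun t => |v t u|) (hV : ∀ u, ∑' t, |v t u| ≤ V)
    {M : Site (3 + 1) → ℝ} (hM : Summable fun u => |M u|) (e : Site (3 + 1)) :
    Summable (Function.uncurry fun (u : Site (3 + 1)) (t : ι) => (v t (u + e) - v t u) * M u) := by
  set g : Site (3 + 1) × ι → ℝ := fun p => (|v p.2 (p.1 + e)| + |v p.2 p.1|) * |M p.1| with hg
  have hg0 : 0 ≤ g := fun p => by rw [hg]; positivity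
  have hgs : Summable g := by
    rw [summable_prod_of_nonneg hg0]
    refine ⟨fun u => ?_, ?_⟩
    · show Summable (fun t => (|v t (u + e)| + |v t u|) * |M u|)
      exact ((habs (u + e)).add (habs u)).mul_right (|M u|)
    · have heq : ∀ u, ∑' t, g (u, t) = ((∑' t, |v t (u + e)|) + ∑' t, |v t u|) * |M u| := fun u => by
        show ∑' t, (|v t (u + e)| + |v t u|) * |M u| = _
        rw [tsum_mul_right, (habs (u + e)).tsum_add (habs u)]
      refine Summable.of_nonneg_of_le (fun u => tsum_nonneg fun t => hg0 (u, t)) (fun u => ?_) (hM.mul_left (V + V))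
      rw [heq u]
      exact mul_le_mul_of_nonneg_right (add_le_add (hV (u + e)) (hV u)) (abs_nonneg _)
  refine Summable.of_norm_bounded hgs (fun p => ?_)
  rw [Real.norm_eq_abs]
  show |(v p.2 (p.1 + e) - v p.2 p.1) * M p.1| ≤ (|v p.2 (p.1 + e)| + |v p.2 p.1|) * |M p.1|
  rw [abs_mul]
  exact mul_le_mul_of_nonneg_right (abs_sub _ _) (abs_nonneg _)

/-- [folklore] **`tsum_shiftDiff_tsum_mul`** — the gradient series of a superposition: for `Σ'_t |v t ·| ≤ V` pointwise and `Σ_u |M u| < ∞`,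
`Σ'_u ((Σ'_t v t (u+e)) − (Σ'_t v t u))·M u = Σ'_t Σ'_u (v t (u+e) − v t u)·M u` (lit `Summable.tsum_sub`, `tsum_mul_right`, ONE Fubini by lit `Summable.tsum_comm'`), and the inner
series are summable in `t`. -/
theorem tsum_shiftDiff_tsum_mul {v : ι → Site (3 + 1) → ℝ} {V : ℝ} (habs : ∀ u, Summable fun t => |v t u|) (hV : ∀ u, ∑' t, |v t u| ≤ V)
    {M : Site (3 + 1) → ℝ} (hM : Summable fun u => |M u|) (e : Site (3 + 1)) :
    (∑' u, ((∑' t, v t (u + e)) - ∑' t, v t u) * M u) = ∑' t, ∑' u, (v t (u + e) - v t u) * M u ∧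
    Summable (fun t => ∑' u, (v t (u + e) - v t u) * M u) := by
  have hs : ∀ u, Summable (fun t => v t u) := fun u => (habs u).of_abs
  have hunc := summable_uncurry_shiftDiff_mul habs hV hM e
  have h₁ : ∀ u, Summable (fun t => (v t (u + e) - v t u) * M u) := fun u => ((hs (u + e)).sub (hs u)).mul_right _
  have h₂ : ∀ t, Summable (fun u => (v t (u + e) - v t u) * M u) := fun t => by
    have hVV : 0 ≤ V + V := by
      have h0 : 0 ≤ V := (tsum_nonneg fun j => abs_nonneg (v j 0)).trans (hV 0)
      linarith
    refine Summable.of_norm_bounded (hM.mul_left (V + V)) (fun u => ?_)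
    rw [Real.norm_eq_abs, abs_mul]
    refine mul_le_mul_of_nonneg_right ((abs_sub _ _).trans (add_le_add ?_ ?_)) (abs_nonneg _)
    · exact abs_le_of_tsum_abs_le habs hV t (u + e)
    · exact abs_le_of_tsum_abs_le habs hV t u
  refine ⟨?_, hunc.prod_symm.prod.congr fun t => rfl⟩
  · calc (∑' u, ((∑' t, v t (u + e)) - ∑' t, v t u) * M u)
        = ∑' u, ∑' t, (v t (u + e) - v t u) * M u := tsum_congr fun u => by
            rw [← (hs (u + e)).tsum_sub (hs u), tsum_mul_right]
      _ = ∑' t, ∑' u, (v t (u + e) - v t u) * M u := (hunc.tsum_comm' h₁ h₂).symm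

/-- [folklore] **`defKerZ_tsum` — THE WARD-DEFECT KERNEL OF AN `ℓ¹`-BOUNDED SUPERPOSITION OF GAUGE FUNCTIONS IS THE SUPERPOSITION OF THE DEFECT KERNELS**:
for `Σ'_t |v t u| ≤ V` at every site and (Lmix) `LocStencilFM L tabs.mixFF C δ` at rate `δ > 0`,
`defKerZ L tabs κ₂ (fun u => Σ'_t v t u) β x w a b = Σ'_t defKerZ L tabs κ₂ (v t) β x w a b`. -/
theorem defKerZ_tsum {C δ : ℝ} (hmix : LocStencilFM L tabs.mixFF C δ) (hδ : 0 < δ) (κ₂ : ℝ)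
    {v : ι → Site (3 + 1) → ℝ} {V : ℝ} (habs : ∀ u, Summable fun t => |v t u|) (hV : ∀ u, ∑' t, |v t u| ≤ V)
    (β : Site (3 + 1) × Fin (3 + 1)) (x w : Site (3 + 1)) (a b : Fib 3) :
    defKerZ L tabs κ₂ (fun u => ∑' t, v t u) β x w a b = ∑' t, defKerZ L tabs κ₂ (v t) β x w a b := by
  have hs : ∀ u, Summable (fun t => v t u) := fun u => (habs u).of_abs
  rcases a with α | m
  · rcases b with α' | m'
    · simp only [defKerZ_apply_inl_inl]
      -- the gradient part, direction by direction
      have hdir : ∀ κ : Fin (3 + 1),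
          (∑' u, ((∑' t, v t (u + unitVec κ)) - ∑' t, v t u) * M2Z L tabs (u, κ) β x w (Sum.inl α) (Sum.inl α'))
            = ∑' t, ∑' u, (v t (u + unitVec κ) - v t u) * M2Z L tabs (u, κ) β x w (Sum.inl α) (Sum.inl α') ∧
          Summable (fun t => ∑' u, (v t (u + unitVec κ) - v t u) * M2Z L tabs (u, κ) β x w (Sum.inl α) (Sum.inl α')) :=
        fun κ => tsum_shiftDiff_tsum_mul habs hV (summable_abs_M2Z_bond L tabs hmix hδ κ β x w (Sum.inl α) (Sum.inl α')) (unitVec κ)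
      have hgrad : (∑ κ : Fin (3 + 1), ∑' u, ((∑' t, v t (u + unitVec κ)) - ∑' t, v t u) * M2Z L tabs (u, κ) β x w (Sum.inl α) (Sum.inl α'))
          = ∑' t, ∑ κ : Fin (3 + 1), ∑' u, (v t (u + unitVec κ) - v t u) * M2Z L tabs (u, κ) β x w (Sum.inl α) (Sum.inl α') := by
        rw [Summable.tsum_finsetSum (fun κ _ => (hdir κ).2)]
        exact Finset.sum_congr rfl fun κ _ => (hdir κ).1
      have hG : Summable (fun t => ∑ κ : Fin (3 + 1), ∑' u, (v t (u + unitVec κ) - v t u) * M2Z L tabs (u, κ) β x w (Sum.inl α) (Sum.inl α')) :=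
        summable_sum fun κ _ => (hdir κ).2
      -- the commutator part
      set H : ℝ := tabs.H β.2 β.1 x w (Sum.inl α) (Sum.inl α') with hH
      have hcomm : (∑' t, v t x) * H - H * ∑' t, v t w = ∑' t, (v t x * H - H * v t w) := by
        rw [← tsum_mul_right, ← tsum_mul_left, ← ((hs x).mul_right H).tsum_sub ((hs w).mul_left H)]
      have hK : Summable (fun t => v t x * H - H * v t w) := ((hs x).mul_right H).sub ((hs w).mul_left H)
      rw [hgrad, hcomm, ← tsum_mul_left, ← hG.tsum_sub (hK.mul_left κ₂)]
    · rw [defKerZ_inr_right]; simp [defKerZ_inr_right]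
  · rw [defKerZ_inr_left]; simp [defKerZ_inr_left]

end Summit.QuantumFields.BalabanUV.Beta.FP.TowerDoorDefectLinear

end
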